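import Summits.CriticalPhenomena.SAWScalingLimit.Theses.SAWDefectDecoherence
import Literature.Probability.LatticeModels.TriangularLatticeProofs
import Summits.CriticalPhenomena.SAWScalingLimit.Theorems.SAWDefectDecoherenceMassRatioSwapArcPositive

/-!
# Crux `SAWDefectDecoherence.MassRatio` (stmt-CriticalPhenomena-8550) — line `flat-root-arc-swap`

Skeleton (crux-plan, round 2) for the crux idea card `Cruxes/MassRatio/Ideas/flat-root-arc-swap.md`
(ideator 6; triage r2: 3 × pass), built on the ideator's `IdeatorSixSketch.lean` (rc 0, 0 sorries;
`domainMono` kernel-proved there and reproduced here).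

**Idea.** `MassRatio` compares, from the WILD boundary root `a_δ`, the normalised bulk mass
`M_K(a_δ) = δ² Σ_{e ∈ K} Z_δ(a_δ → e)` with the boundary POINT mass `Z_δ(a_δ → b_δ)` at the cut
`δ^{-3/4}` (predicted ratio `δ^{-25/48}`, slack `11/48`). The line SWAPS THE ROOT onto the flat
lattice piece at `b` and AVERAGES it over the far arc `S_δ = {e ∈ ∂Λ_δ : ρ/4 ≤ |δ·mid e − b| ≤ ρ/2}`
of that piece: summing the cross-ratio (root-insensitivity) inequality
`Z(a→K)·Z(b→a') ≤ Cδ^{-ε}·Z(a→b)·Z(a'→K)` over `a' ∈ S_δ` (`stub_rootSwapArc`, predicted exponent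
`ε = 0`, filed for every `ε > 0`) makes the wild root disappear, turns the point `b_δ` into a ROOT
(roots are pointwise for free) and its partner into the ARC `S_δ`. What is left is
`stub_arcMassRatio`: arc-rooted normalised bulk mass `Σ_{a'∈S_δ} M_K(a')` against the far-arc arrival
mass `Z_{H_δ}(b_δ → S_δ)` from the TAME root `b_δ` inside the explicit lattice half-disc
`H_δ = Λ_δ ∩ B(b, 3ρ/4)` (sandwiched into `Λ_δ` by the rows clause and `domainMono`), at some cut
`c < 3/4` — no pointwise quantity, no wild geometry on the boundary side, every sum-rule
coefficient from `b_δ` in `H_δ` is `≥ cos(3π/8)`. The division by the arc mass needs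
`stub_swapArcPositive` (provable now). Composition: `MassRatioAt (c + ε)` from
`RootSwapArc ε ∧ ArcMassRatio c ∧ SwapArcPositive` (`massRatioAt_of`, PROVED), and
`MassRatio_of : SAWDefectDecoherence.MassRatio` at `ε := 3/4 − c`.

**Registered stubs (sorry only there; signatures fully expanded over Literature/Mathlib).**
* `stub_rootSwapArc` — `∀ ε > 0`, root swap summed over the swap arc (XL/open; separation type;
  load-bearing for the "change of root"; carries the pointwise-at-`b_δ` content, triage r2-2).
* `stub_arcMassRatio` — `∃ c < 3/4`, `ArcMassRatio c` (XL/open-problem; HARDEST: the two sharp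
  exponent certifications of the necessity ledger live here, `arcMassRatio_of_split`).
* `stub_swapArcPositive` — eventually `Z_{Λ_δ}(b_δ → S_δ) > 0` (M) — **CLOSED** (lead a1-1, wave 1,
  p96866 `Theorems/SAWDefectDecoherenceMassRatioSwapArcPositive.lean`; the skeleton now cites it).

**Proved here (axioms `propext`, `Classical.choice`, `Quot.sound`).** `massRatioAt_of` (First
lemma / Transfer at a general cut `c + ε`), `rootSwapArc_of_rootSwap` (pointwise ⇒ arc form),
`arcMassRatio_of_split` (`HalfDiscArcArrival B → ArcRootedBulkMass A → A + B ≤ c → ArcMassRatio c`: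
the typed two-certification form of the conjecture node, for the lead / tenure planner),
`domainMono` (`Λ' ⊆ Λ ⇒ Z_{Λ'} ≤ Z_Λ`), finiteness of mid-edge / boundary / swap-arc sets,
`MassRatio_of`.

**Disproof used** (`Cruxes/MassRatio/Disproof.lean` + `DisproofExhaustion/StarAlgebra/AnyCut/
Component`, cycles 1–4, verdict RESISTS; landed `Theorems/MassRatio/Negative/*`). Honoured theorem by
theorem: `massRatio_false_without_exhaustion` / `massRatioAt_false_without_exhaustion` — exhaustion
is consumed by `stub_rootSwapArc` (the cross ratio is `≥ x_c^{-(2L₃−4i_K)} → ∞` on the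
exhaustion-free corridor family `Λ₃`) and by `stub_arcMassRatio` (bulk around `K`, passage from `K`
to the flat piece); `massRatio_false_without_rows` / `_without_rho_pos` — the swap arc `S_δ` is a set
of door edges of the flat piece and `H_δ ⊆ Λ_δ` is lattice-exact ONLY by the rows clause with
`ρ > 0` (`stub_arcMassRatio`, `stub_swapArcPositive`); `massRatio_false_without_bLimit` —
`δ·mid b_δ → b` centres `S_δ` and `H_δ` at the root `b_δ` (`stub_swapArcPositive`: the slab family's
drifting `b_δ` has no reachable flat arc around it); `nonempty_saw_of_preconnected`,
`massRatio_iff_withoutPreconnected` — decoration, kept verbatim inside the frame (harmless: the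
stubs only weaken); `Negative.verts_eq_corridor` / `corridor_transfer` — consistent: a bare root
corridor is an exact common factor of `Z(a→K)` and `Z(a→b)` in the cross ratio;
`Negative.massRatio_frame_nonvacuous` (RowsB) — the common frame of the three stubs is the crux's
frame verbatim, hence satisfiable (`D₀, ρ = 1, ΛR, mRow, aE, bE`); §J `star_identity`/`star_bounds`
and the dead line's W1/W2 — not touched: no `F_{5/8}`, no floor, no modulus Harnack appears. No stub
is an instance of a landed Negative lemma: every stub keeps all four load-bearing clauses, and the
refuted statements of the sub (0772, 5420, 8261, 8312) concern all-δ tightness / the root's conformal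
position, which the root swap removes rather than pins.

**Triage r2 acted on.** r2-1 sharpen 2 / r2-3 sharpen: the constant `C` of `stub_rootSwapArc` is
quantified after the frame and `K` and before `∀ᶠ δ` (frame- and `K`-dependent, `δ`-free), and the
`Λ₃` failure is recorded above; r2-2 doubt: the line card budgets `stub_rootSwapArc` as a HARD stub
(pointwise-at-`b_δ` content), not an "ε = 0 side condition"; r2-2 note on `LineTarget`: the
composition is typed with `∃ c < 3/4` on the arc side and `ε := 3/4 − c`, useful for
`c ∈ [25/48, 3/4)` only (predictions), which is what the existential leaves to the prover; r2-1
sharpen 1 (canonical family `Λ_δ^max(m)`) and the pairing with `renewal-averaging-at-b` are recorded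
in the line card as reshape options, not typed here; all: rows / `ρ > 0` / `b_δ → b` / exhaustion
carried explicitly in every stub; `MassRatio(3/4)` is false for simple random walk (`a = 1, b = 0`),
so RW-level inputs (`escape_ge`, Hammersley–Welsh) are provably insufficient for `stub_arcMassRatio`.
-/

namespace Summit.CriticalPhenomena.SAWScalingLimit.Cruxes.MassRatio.FlatRootArcSwap

open Literature.Probability.LatticeModels Literature.Probability.RandomPlanarGeometry
open Literature.Probability.RandomPlanarGeometry.SAW
open Summit.CriticalPhenomena.SAWScalingLimit.Theses.SAWDefectDecoherence

noncomputable section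
open scoped Classical

/-! ## Stubs (registered; `sorry` only here)

All three stubs are stated over the crux's hypothesis frame VERBATIM (curried, in the crux's
order: `0 < ρ`, flatness of `D` at `b = D.pt 1` on `B(b,ρ)`, the eventual admissibility clause
with the ROWS clause, exhaustion of compacts, `δ·mid a_δ → a`, `δ·mid b_δ → b`) and over
Literature / Mathlib declarations only, so that a `Theorems/` file can restate them literally.
Notation used in the comments: `Z_Λ(r → z) := ‖F_{Λ, r, x_c, σ=0}(z)‖ = Σ_{γ ⊂ Λ : r → z} x_c^{ℓ(γ)}`;
the SWAP ARC `S_δ := {e ∈ ∂Λ_δ : ρ/4 ≤ |δ·mid e − b| ≤ ρ/2}` (by the rows clause: the door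
mid-edges of the flat zigzag piece at scaled distance `∈ [ρ/4, ρ/2]` from `b`; `#S_δ ≍ ρ/δ`);
the normalised `K`-mass from a root `r`: `M_K(r) := δ² Σ_{e ∈ E(Λ_δ), δ·mid e ∈ K} Z_{Λ_δ}(r → e)`;
the lattice half-disc `H_δ := {v ∈ Λ_δ : |δ·c_v − b| < 3ρ/4}` (lattice-exact by the rows clause). -/

/-- **Stub 1 — `RootSwapArc(ε)` for every `ε > 0` (root swap, arc-averaged; the "change of root"
lemma).** In the frame of `MassRatio`, for every compact `K ⊆ Ω` there is `C` (depending on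
`D, ρ`, the family `Λ`, `m, a, b` and `K`, NOT on `δ`) with, eventually as `δ → 0+`,
`M_K(a_δ) · Z_{Λ_δ}(b_δ → S_δ) ≤ C δ^{-ε} · Z_{Λ_δ}(a_δ → b_δ) · Σ_{a' ∈ S_δ} M_K(a')`,
where `Z_{Λ_δ}(b_δ → S_δ) = Σ_{a'∈S_δ} Z_{Λ_δ}(b_δ → a')`. It is the sum over `a' ∈ S_δ` of the
cross-ratio inequality `Z(a→K)·Z(b→a') ≤ Cδ^{-ε}·Z(a→b)·Z(a'→K)` (`RootSwap`, pointwise in `a'`,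
see `rootSwapArc_of_rootSwap`): root insensitivity of the bulk-to-boundary mass ratio, predicted
with exponent `0` (every `ε > 0` is slack). Why plausibly true: at predicted exponents the cross
ratio is `δ^{a+b}δ^{2a}/(δ^{2a}δ^{a+b}) = O(1)` (`a = h_b = 5/8`, `b = x₁ = 5/48`); root-side
corridors / fjords at `a_δ` are exact common factors of `Z(a→K)` and `Z(a→b)`
(`Negative.verts_eq_corridor`), macroscopic necks are frame constants absorbed by `∃ C`, and the
arc `S_δ` is frozen by the rows clause; cross-field analogues are theorems (Masson's separation
lemma for LERW arXiv:0806.0357, Nolin's quasi-multiplicativity arXiv:0711.4948). USES EXHAUSTION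
quantitatively: for the exhaustion-free corridor family `Λ₃` of `DisproofExhaustion` the cross
ratio is `≥ x_c^{-(2L₃-4i_K)} → ∞` (cdisprove §K, `massRatio_false_without_exhaustion`). Honest
warning (triage r2-2): this stub is where the POINTWISE lower bound at `b_δ` now lives
(`RootSwapArc(ε) ⟺ Z(a→b_δ) ≥ C⁻¹δ^{ε}·M_K(a)·Z_Λ(b→S_δ)/Σ_{a'}M_K(a')`); no SAW tool (harmonic
measure / RSW) is available — size XL / open, of independent value. Exact enumeration (card,
`toy/rootswap.py`, |V| ≤ 78): cross ratio ∈ [1.44, 2.27], O(1) but pre-asymptotic. -/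
theorem stub_rootSwapArc : ∀ ε : ℝ, 0 < ε →
    ∀ (D : DobrushinDomain) (ρ : ℝ) (Λ : ℝ → Finset HexVertex) (m : ℝ → ℤ)
      (a b : ℝ → Sym2 HexVertex),
      0 < ρ →
      D.carrier ∩ Metric.ball (D.pt 1) ρ = {z : ℂ | (D.pt 1).im < z.im} ∩ Metric.ball (D.pt 1) ρ →
      (∀ᶠ δ : ℝ in nhdsWithin 0 (Set.Ioi 0),
        hexDomainSimplyConnected (Λ δ) ∧ a δ ∈ hexDomainBoundary (Λ δ) ∧
          b δ ∈ hexDomainBoundary (Λ δ) ∧ Nonempty (HexMidEdgeSAW (Λ δ) (a δ) (b δ)) ∧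
          (hexGraph.induce ((Λ δ : Finset HexVertex) : Set HexVertex)).Preconnected ∧
          (∀ v ∈ Λ δ, (δ : ℂ) * hexCenter v ∈ D.carrier) ∧
          (∀ v : HexVertex, (δ : ℂ) * hexCenter v ∈ Metric.ball (D.pt 1) ρ →
            (v ∈ Λ δ ↔ m δ ≤ v.1 1))) →
      (∀ K : Set ℂ, IsCompact K → K ⊆ D.carrier → ∀ᶠ δ : ℝ in nhdsWithin 0 (Set.Ioi 0),
        ∀ v : HexVertex, (δ : ℂ) * hexCenter v ∈ K → v ∈ Λ δ) →
      Filter.Tendsto (fun δ : ℝ => (δ : ℂ) * hexMidpoint (a δ)) (nhdsWithin 0 (Set.Ioi 0))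
        (nhds (D.pt 0)) →
      Filter.Tendsto (fun δ : ℝ => (δ : ℂ) * hexMidpoint (b δ)) (nhdsWithin 0 (Set.Ioi 0))
        (nhds (D.pt 1)) →
      ∀ K : Set ℂ, IsCompact K → K ⊆ D.carrier → ∃ C : ℝ,
        ∀ᶠ δ : ℝ in nhdsWithin 0 (Set.Ioi 0),
          (δ ^ 2 * ∑ᶠ e ∈ {e : Sym2 HexVertex | e ∈ hexDomainMidEdges (Λ δ) ∧
              (δ : ℂ) * hexMidpoint e ∈ K},
              ‖hexParafermionicObservable (Λ δ) (a δ) hexCriticalFugacity 0 e‖) *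
            (∑ᶠ a' ∈ {e : Sym2 HexVertex | e ∈ hexDomainBoundary (Λ δ) ∧
              ρ / 4 ≤ dist ((δ : ℂ) * hexMidpoint e) (D.pt 1) ∧
              dist ((δ : ℂ) * hexMidpoint e) (D.pt 1) ≤ ρ / 2},
              ‖hexParafermionicObservable (Λ δ) (b δ) hexCriticalFugacity 0 a'‖) ≤
          C * δ ^ (-ε) * ‖hexParafermionicObservable (Λ δ) (a δ) hexCriticalFugacity 0 (b δ)‖ *
            ∑ᶠ a' ∈ {e : Sym2 HexVertex | e ∈ hexDomainBoundary (Λ δ) ∧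
              ρ / 4 ≤ dist ((δ : ℂ) * hexMidpoint e) (D.pt 1) ∧
              dist ((δ : ℂ) * hexMidpoint e) (D.pt 1) ≤ ρ / 2},
              (δ ^ 2 * ∑ᶠ e ∈ {e : Sym2 HexVertex | e ∈ hexDomainMidEdges (Λ δ) ∧
                (δ : ℂ) * hexMidpoint e ∈ K},
                ‖hexParafermionicObservable (Λ δ) a' hexCriticalFugacity 0 e‖) := by
  sorry

/-- **Stub 2 — `ArcMassRatio(c)` for some `c < 3/4` (the crux with the root swapped onto the flat
piece and averaged over the swap arc; HARDEST).** In the frame of `MassRatio` there is an exponent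
`c < 3/4` such that for every compact `K ⊆ Ω` some `C` (frame- and `K`-dependent, not on `δ`)
satisfies, eventually as `δ → 0+`,
`Σ_{a' ∈ S_δ} M_K(a') ≤ C δ^{-c} · Σ_{a' ∈ S_δ} Z_{H_δ}(b_δ → a')`:
ARC-ROOTED normalised bulk mass against the FAR-ARC ARRIVAL MASS FROM THE TAME ROOT `b_δ` inside
the explicit lattice half-disc `H_δ = Λ_δ ∩ B(b, 3ρ/4)` (flat zigzag bottom by the rows clause;
every exit of `H_δ` from `b_δ` has `|W| ≤ π`, so all Duminil-Copin–Smirnov sum-rule coefficients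
are `≥ cos(3π/8)`). No pointwise quantity, no wild geometry on the boundary side. Predicted:
LHS `≍ (ρ/δ)·δ^{a+b} = δ^{-13/48}`, RHS arc mass `≍ (ρ/δ)·δ^{2a} = δ^{12/48}`, so the inequality
holds iff `c ≥ 25/48`; the stub asks for SOME `c < 36/48` (slack `11/48`). Why it might fail /
status: this is the conjecture node of the necessity ledger (`Ideator6Necessity.md`): any proof
certifies a far-arc arrival lower bound `Z_{H_δ}(b_δ → S_δ) ≥ c₀δ^{B}` and an arc-rooted bulk
upper bound `Σ M_K(a') ≤ Cδ^{-A}` with `A + B ≤ c` (`arcMassRatio_of_split`), truths `B = 1/4`,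
`A = 13/48`, i.e. both within `0.23` of their conjectured values; rigorous today: `B = 1` at arc
level (`HexSAWEscapeMass.escape_ge`, DCS Lemma 2 / Remark 2), no polynomial `A` at all
(Hammersley–Welsh `HV.hSum_le_prod` gives `exp(cN^{1-ε})`; barrier `SAWNoUnitaryCFT`: no
infrared upper bounds). `MassRatio(3/4)` is FALSE for simple random walk (`a = 1, b = 0`), so the
proof must use self-avoidance quantitatively (per-octave boundary factor `≥ 2^{-3/4}` vs SRW `1/2`).
USES EXHAUSTION (bulk around `K`, passage from `K` to the flat piece) and the rows clause + `ρ > 0`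
(the sandwich `H_δ ⊆ Λ_δ`, `S_δ` = door edges). Size XL / open-problem (sharp-exponent class).
Sources: DuminilCopinSmirnov2012 (arXiv:1007.0575) Lemma 2, §3; BBDDG arXiv:1109.0358 Prop. 4, 9;
Beaton–Guttmann–Jensen arXiv:1110.1141 p. 4 (`B_T ∼ cT^{-1/4}`); LawlerSchrammWerner2004SAW §3;
Krachun–Panagiotis arXiv:2310.17299; Madras 2014 doi:10.4153/cmb-2012-022-6. -/
theorem stub_arcMassRatio : ∃ c : ℝ, c < 3 / 4 ∧
    ∀ (D : DobrushinDomain) (ρ : ℝ) (Λ : ℝ → Finset HexVertex) (m : ℝ → ℤ)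
      (a b : ℝ → Sym2 HexVertex),
      0 < ρ →
      D.carrier ∩ Metric.ball (D.pt 1) ρ = {z : ℂ | (D.pt 1).im < z.im} ∩ Metric.ball (D.pt 1) ρ →
      (∀ᶠ δ : ℝ in nhdsWithin 0 (Set.Ioi 0),
        hexDomainSimplyConnected (Λ δ) ∧ a δ ∈ hexDomainBoundary (Λ δ) ∧
          b δ ∈ hexDomainBoundary (Λ δ) ∧ Nonempty (HexMidEdgeSAW (Λ δ) (a δ) (b δ)) ∧
          (hexGraph.induce ((Λ δ : Finset HexVertex) : Set HexVertex)).Preconnected ∧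
          (∀ v ∈ Λ δ, (δ : ℂ) * hexCenter v ∈ D.carrier) ∧
          (∀ v : HexVertex, (δ : ℂ) * hexCenter v ∈ Metric.ball (D.pt 1) ρ →
            (v ∈ Λ δ ↔ m δ ≤ v.1 1))) →
      (∀ K : Set ℂ, IsCompact K → K ⊆ D.carrier → ∀ᶠ δ : ℝ in nhdsWithin 0 (Set.Ioi 0),
        ∀ v : HexVertex, (δ : ℂ) * hexCenter v ∈ K → v ∈ Λ δ) →
      Filter.Tendsto (fun δ : ℝ => (δ : ℂ) * hexMidpoint (a δ)) (nhdsWithin 0 (Set.Ioi 0))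
        (nhds (D.pt 0)) →
      Filter.Tendsto (fun δ : ℝ => (δ : ℂ) * hexMidpoint (b δ)) (nhdsWithin 0 (Set.Ioi 0))
        (nhds (D.pt 1)) →
      ∀ K : Set ℂ, IsCompact K → K ⊆ D.carrier → ∃ C : ℝ,
        ∀ᶠ δ : ℝ in nhdsWithin 0 (Set.Ioi 0),
          (∑ᶠ a' ∈ {e : Sym2 HexVertex | e ∈ hexDomainBoundary (Λ δ) ∧
              ρ / 4 ≤ dist ((δ : ℂ) * hexMidpoint e) (D.pt 1) ∧
              dist ((δ : ℂ) * hexMidpoint e) (D.pt 1) ≤ ρ / 2},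
              (δ ^ 2 * ∑ᶠ e ∈ {e : Sym2 HexVertex | e ∈ hexDomainMidEdges (Λ δ) ∧
                (δ : ℂ) * hexMidpoint e ∈ K},
                ‖hexParafermionicObservable (Λ δ) a' hexCriticalFugacity 0 e‖)) ≤
          C * δ ^ (-c) *
            ∑ᶠ a' ∈ {e : Sym2 HexVertex | e ∈ hexDomainBoundary (Λ δ) ∧
              ρ / 4 ≤ dist ((δ : ℂ) * hexMidpoint e) (D.pt 1) ∧
              dist ((δ : ℂ) * hexMidpoint e) (D.pt 1) ≤ ρ / 2},
              ‖hexParafermionicObservable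
                  ((Λ δ).filter fun v => dist ((δ : ℂ) * hexCenter v) (D.pt 1) < 3 * ρ / 4)
                  (b δ) hexCriticalFugacity 0 a'‖ := by
  sorry

/-- **Stub 3 — `SwapArcPositive` (non-degeneracy of the swap arc; provable now, size M).** In the
frame of `MassRatio`, eventually as `δ → 0+` the arc mass `Z_{Λ_δ}(b_δ → S_δ) = Σ_{a'∈S_δ}
Z_{Λ_δ}(b_δ → a')` is POSITIVE. Lattice geometry of the rows clause: by `b_δ ∈ ∂Λ_δ`,
`δ·mid b_δ → b` and the rows clause, `b_δ` is eventually a door edge `{(m-1,p_b),(m,p_b)}` of the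
flat zigzag piece; since `ρ > 0`, for `δ` small the door edges `{(m-1,p),(m,p)}` with
`δ|p - p_b|/2 ∈ [ρ/4 + δ, ρ/2 - δ]` belong to `S_δ` (they are boundary mid-edges of `Λ_δ` by the
rows clause, at scaled distance `∈ [ρ/4, ρ/2]` from `b`), so `S_δ ≠ ∅`; and the horizontal run
along row `m` from `(m,p_b)` to `(m,p)` stays inside `B(b,ρ)`, hence inside `Λ_δ` (rows clause),
and is a self-avoiding walk `b_δ → a'`, whence `Z_{Λ_δ}(b_δ → a') ≥ x_c^{|p-p_b|+1} > 0`
(`Negative.pow_length_le_norm_Z`, brick coordinates `Negative.bv`, `Negative.linked_run`). This is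
the division step of the glue; it is where the line uses `0 < ρ` and `δ·mid b_δ → b`
(`massRatio_false_without_rho_pos`, `massRatio_false_without_bLimit`: without them `S_δ` may be
empty or unreachable). Why it might fail: it does not (it is a lemma); listed as a stub because it
is a genuine M-sized lattice construction, not bookkeeping. -/
theorem stub_swapArcPositive :
    ∀ (D : DobrushinDomain) (ρ : ℝ) (Λ : ℝ → Finset HexVertex) (m : ℝ → ℤ)
      (a b : ℝ → Sym2 HexVertex),
      0 < ρ →
      D.carrier ∩ Metric.ball (D.pt 1) ρ = {z : ℂ | (D.pt 1).im < z.im} ∩ Metric.ball (D.pt 1) ρ →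
      (∀ᶠ δ : ℝ in nhdsWithin 0 (Set.Ioi 0),
        hexDomainSimplyConnected (Λ δ) ∧ a δ ∈ hexDomainBoundary (Λ δ) ∧
          b δ ∈ hexDomainBoundary (Λ δ) ∧ Nonempty (HexMidEdgeSAW (Λ δ) (a δ) (b δ)) ∧
          (hexGraph.induce ((Λ δ : Finset HexVertex) : Set HexVertex)).Preconnected ∧
          (∀ v ∈ Λ δ, (δ : ℂ) * hexCenter v ∈ D.carrier) ∧
          (∀ v : HexVertex, (δ : ℂ) * hexCenter v ∈ Metric.ball (D.pt 1) ρ →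
            (v ∈ Λ δ ↔ m δ ≤ v.1 1))) →
      (∀ K : Set ℂ, IsCompact K → K ⊆ D.carrier → ∀ᶠ δ : ℝ in nhdsWithin 0 (Set.Ioi 0),
        ∀ v : HexVertex, (δ : ℂ) * hexCenter v ∈ K → v ∈ Λ δ) →
      Filter.Tendsto (fun δ : ℝ => (δ : ℂ) * hexMidpoint (a δ)) (nhdsWithin 0 (Set.Ioi 0))
        (nhds (D.pt 0)) →
      Filter.Tendsto (fun δ : ℝ => (δ : ℂ) * hexMidpoint (b δ)) (nhdsWithin 0 (Set.Ioi 0))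
        (nhds (D.pt 1)) →
      ∀ᶠ δ : ℝ in nhdsWithin 0 (Set.Ioi 0),
        0 < ∑ᶠ a' ∈ {e : Sym2 HexVertex | e ∈ hexDomainBoundary (Λ δ) ∧
              ρ / 4 ≤ dist ((δ : ℂ) * hexMidpoint e) (D.pt 1) ∧
              dist ((δ : ℂ) * hexMidpoint e) (D.pt 1) ≤ ρ / 2},
              ‖hexParafermionicObservable (Λ δ) (b δ) hexCriticalFugacity 0 a'‖ :=
  -- LANDED (wave 1, p96866): `Theorems/SAWDefectDecoherenceMassRatioSwapArcPositive.lean`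
  Summit.CriticalPhenomena.SAWScalingLimit.Theorems.MassRatio.ArcSwap.stub_swapArcPositive

/-! ## The objects of the line and the stub statements as predicates in the exponent -/

/-- `σ = 0` mass `Z_Λ(r → z) = Σ_{γ ⊂ Λ : r → z} x_c^{ℓ(γ)}` (norm of the spin-0 observable). -/
def Zm (Λ : Finset HexVertex) (r z : Sym2 HexVertex) : ℝ :=
  ‖hexParafermionicObservable Λ r hexCriticalFugacity 0 z‖

theorem Zm_nonneg (Λ : Finset HexVertex) (r z : Sym2 HexVertex) : 0 ≤ Zm Λ r z := norm_nonneg _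

/-- The hypothesis frame of `MassRatio` (its six curried hypotheses, verbatim, as one predicate). -/
def Frame (D : DobrushinDomain) (ρ : ℝ) (Λ : ℝ → Finset HexVertex) (m : ℝ → ℤ)
    (a b : ℝ → Sym2 HexVertex) : Prop :=
  0 < ρ ∧
  D.carrier ∩ Metric.ball (D.pt 1) ρ = {z : ℂ | (D.pt 1).im < z.im} ∩ Metric.ball (D.pt 1) ρ ∧
  (∀ᶠ δ : ℝ in nhdsWithin 0 (Set.Ioi 0),
      hexDomainSimplyConnected (Λ δ) ∧ a δ ∈ hexDomainBoundary (Λ δ) ∧ b δ ∈ hexDomainBoundary (Λ δ) ∧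
      Nonempty (HexMidEdgeSAW (Λ δ) (a δ) (b δ)) ∧
      (hexGraph.induce ((Λ δ : Finset HexVertex) : Set HexVertex)).Preconnected ∧
      (∀ v ∈ Λ δ, (δ : ℂ) * hexCenter v ∈ D.carrier) ∧
      (∀ v : HexVertex, (δ : ℂ) * hexCenter v ∈ Metric.ball (D.pt 1) ρ → (v ∈ Λ δ ↔ m δ ≤ v.1 1))) ∧
  (∀ K : Set ℂ, IsCompact K → K ⊆ D.carrier → ∀ᶠ δ : ℝ in nhdsWithin 0 (Set.Ioi 0),
      ∀ v : HexVertex, (δ : ℂ) * hexCenter v ∈ K → v ∈ Λ δ) ∧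
  Filter.Tendsto (fun δ : ℝ => (δ : ℂ) * hexMidpoint (a δ)) (nhdsWithin 0 (Set.Ioi 0)) (nhds (D.pt 0)) ∧
  Filter.Tendsto (fun δ : ℝ => (δ : ℂ) * hexMidpoint (b δ)) (nhdsWithin 0 (Set.Ioi 0)) (nhds (D.pt 1))

/-- The SWAP ARC `S_δ`: boundary mid-edges of `Λ_δ` at scaled distance `∈ [ρ/4, ρ/2]` from `b`. -/
def swapArc (D : DobrushinDomain) (ρ : ℝ) (Λ : ℝ → Finset HexVertex) (δ : ℝ) :
    Set (Sym2 HexVertex) :=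
  {e : Sym2 HexVertex | e ∈ hexDomainBoundary (Λ δ) ∧
    ρ / 4 ≤ dist ((δ : ℂ) * hexMidpoint e) (D.pt 1) ∧ dist ((δ : ℂ) * hexMidpoint e) (D.pt 1) ≤ ρ / 2}

/-- Normalised `K`-mass from the root `r`: `M_K(r) = δ² Σ_{e ∈ E(Λ), δ·mid e ∈ K} Z_Λ(r → e)`
(the crux's left-hand side for `r = a_δ`). -/
def massK (Λ : Finset HexVertex) (r : Sym2 HexVertex) (δ : ℝ) (K : Set ℂ) : ℝ :=
  δ ^ 2 * ∑ᶠ e ∈ {e : Sym2 HexVertex | e ∈ hexDomainMidEdges Λ ∧ (δ : ℂ) * hexMidpoint e ∈ K},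
    Zm Λ r e

/-- The lattice half-disc `H_δ := {v ∈ Λ_δ : |δ·c_v − b| < 3ρ/4}` (lattice-exact with flat zigzag
bottom by the rows clause). -/
def halfDisc (D : DobrushinDomain) (ρ : ℝ) (Λ : ℝ → Finset HexVertex) (δ : ℝ) : Finset HexVertex :=
  (Λ δ).filter fun v => dist ((δ : ℂ) * hexCenter v) (D.pt 1) < 3 * ρ / 4

/-- `MassRatio` at the exponent cut `c` (the crux is `MassRatioAt (3/4)`, see `MassRatio_of`). -/
def MassRatioAt (c : ℝ) : Prop :=
  ∀ (D : DobrushinDomain) (ρ : ℝ) (Λ : ℝ → Finset HexVertex) (m : ℝ → ℤ) (a b : ℝ → Sym2 HexVertex),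
    Frame D ρ Λ m a b → ∀ K : Set ℂ, IsCompact K → K ⊆ D.carrier → ∃ C : ℝ,
      ∀ᶠ δ : ℝ in nhdsWithin 0 (Set.Ioi 0),
        massK (Λ δ) (a δ) δ K ≤ C * δ ^ (-c) * Zm (Λ δ) (a δ) (b δ)

/-- `RootSwap(ε)`, POINTWISE in `a' ∈ S_δ` (the cross-ratio inequality of the card; stronger than
the registered arc form, see `rootSwapArc_of_rootSwap`). -/
def RootSwap (ε : ℝ) : Prop :=
  ∀ (D : DobrushinDomain) (ρ : ℝ) (Λ : ℝ → Finset HexVertex) (m : ℝ → ℤ) (a b : ℝ → Sym2 HexVertex),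
    Frame D ρ Λ m a b → ∀ K : Set ℂ, IsCompact K → K ⊆ D.carrier → ∃ C : ℝ,
      ∀ᶠ δ : ℝ in nhdsWithin 0 (Set.Ioi 0), ∀ a' ∈ swapArc D ρ Λ δ,
        massK (Λ δ) (a δ) δ K * Zm (Λ δ) (b δ) a' ≤
          C * δ ^ (-ε) * Zm (Λ δ) (a δ) (b δ) * massK (Λ δ) a' δ K

/-- `RootSwapArc(ε)` — the statement of `stub_rootSwapArc` at one `ε`. -/
def RootSwapArc (ε : ℝ) : Prop :=
  ∀ (D : DobrushinDomain) (ρ : ℝ) (Λ : ℝ → Finset HexVertex) (m : ℝ → ℤ) (a b : ℝ → Sym2 HexVertex),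
    Frame D ρ Λ m a b → ∀ K : Set ℂ, IsCompact K → K ⊆ D.carrier → ∃ C : ℝ,
      ∀ᶠ δ : ℝ in nhdsWithin 0 (Set.Ioi 0),
        massK (Λ δ) (a δ) δ K * ∑ᶠ a' ∈ swapArc D ρ Λ δ, Zm (Λ δ) (b δ) a' ≤
          C * δ ^ (-ε) * Zm (Λ δ) (a δ) (b δ) * ∑ᶠ a' ∈ swapArc D ρ Λ δ, massK (Λ δ) a' δ K

/-- `ArcMassRatio(c)` — the statement of `stub_arcMassRatio` at one `c`. -/
def ArcMassRatio (c : ℝ) : Prop :=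
  ∀ (D : DobrushinDomain) (ρ : ℝ) (Λ : ℝ → Finset HexVertex) (m : ℝ → ℤ) (a b : ℝ → Sym2 HexVertex),
    Frame D ρ Λ m a b → ∀ K : Set ℂ, IsCompact K → K ⊆ D.carrier → ∃ C : ℝ,
      ∀ᶠ δ : ℝ in nhdsWithin 0 (Set.Ioi 0),
        ∑ᶠ a' ∈ swapArc D ρ Λ δ, massK (Λ δ) a' δ K ≤
          C * δ ^ (-c) * ∑ᶠ a' ∈ swapArc D ρ Λ δ, Zm (halfDisc D ρ Λ δ) (b δ) a'

/-- `SwapArcPositive` — the statement of `stub_swapArcPositive`. -/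
def SwapArcPositive : Prop :=
  ∀ (D : DobrushinDomain) (ρ : ℝ) (Λ : ℝ → Finset HexVertex) (m : ℝ → ℤ) (a b : ℝ → Sym2 HexVertex),
    Frame D ρ Λ m a b → ∀ᶠ δ : ℝ in nhdsWithin 0 (Set.Ioi 0),
      0 < ∑ᶠ a' ∈ swapArc D ρ Λ δ, Zm (Λ δ) (b δ) a'

/-- Far-arc arrival lower bound from the tame root at exponent `B` (boundary half of the
absolute split of `ArcMassRatio`; truth `B = 1/4`, rigorous today `B = 1`). -/
def HalfDiscArcArrival (B : ℝ) : Prop :=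
  ∀ (D : DobrushinDomain) (ρ : ℝ) (Λ : ℝ → Finset HexVertex) (m : ℝ → ℤ) (a b : ℝ → Sym2 HexVertex),
    Frame D ρ Λ m a b → ∃ c₀ : ℝ, 0 < c₀ ∧ ∀ᶠ δ : ℝ in nhdsWithin 0 (Set.Ioi 0),
      c₀ * δ ^ B ≤ ∑ᶠ a' ∈ swapArc D ρ Λ δ, Zm (halfDisc D ρ Λ δ) (b δ) a'

/-- Arc-rooted normalised bulk mass upper bound at exponent `A` (bulk half of the absolute split
of `ArcMassRatio`; truth `A = 13/48`, rigorous today: no polynomial bound). -/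
def ArcRootedBulkMass (A : ℝ) : Prop :=
  ∀ (D : DobrushinDomain) (ρ : ℝ) (Λ : ℝ → Finset HexVertex) (m : ℝ → ℤ) (a b : ℝ → Sym2 HexVertex),
    Frame D ρ Λ m a b → ∀ K : Set ℂ, IsCompact K → K ⊆ D.carrier → ∃ C : ℝ,
      ∀ᶠ δ : ℝ in nhdsWithin 0 (Set.Ioi 0),
        ∑ᶠ a' ∈ swapArc D ρ Λ δ, massK (Λ δ) a' δ K ≤ C * δ ^ (-A)

/-! ## The stubs deliver the predicates (definitional unfolding only) -/

theorem rootSwapArc_of_stub {ε : ℝ} (hε : 0 < ε) : RootSwapArc ε := by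
  intro D ρ Λ m a b hF K hK hKD
  obtain ⟨hρ, hflat, hadm, hexh, ha, hb⟩ := hF
  exact stub_rootSwapArc ε hε D ρ Λ m a b hρ hflat hadm hexh ha hb K hK hKD

theorem arcMassRatio_of_stub : ∃ c : ℝ, c < 3 / 4 ∧ ArcMassRatio c := by
  obtain ⟨c, hc, h⟩ := stub_arcMassRatio
  refine ⟨c, hc, ?_⟩
  intro D ρ Λ m a b hF K hK hKD
  obtain ⟨hρ, hflat, hadm, hexh, ha, hb⟩ := hF
  exact h D ρ Λ m a b hρ hflat hadm hexh ha hb K hK hKD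

theorem swapArcPositive_of_stub : SwapArcPositive := by
  intro D ρ Λ m a b hF
  obtain ⟨hρ, hflat, hadm, hexh, ha, hb⟩ := hF
  exact stub_swapArcPositive D ρ Λ m a b hρ hflat hadm hexh ha hb

/-! ## Lattice helpers (proved): finiteness of the edge sets, domain monotonicity -/

/-- Every face has finitely many (three) neighbours. -/
theorem finite_setOf_adj (v : HexVertex) : {t : HexVertex | hexGraph.Adj v t}.Finite := by
  obtain ⟨y, i⟩ := v
  fin_cases i
  · refine (Set.toFinite ({(y, 1), (y - Pi.single 0 1, 1), (y - Pi.single 1 1, 1)} :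
      Set HexVertex)).subset ?_
    rintro ⟨z, j⟩ ht
    fin_cases j
    · exact absurd ht (not_hexGraph_adj_of_snd_eq_holds _ _ rfl)
    · rcases (hexGraph_adj_iff_of_snd_eq_zero_holds y z).1 ht with rfl | rfl | rfl <;> simp
  · refine (Set.toFinite ({(y, 0), (y + Pi.single 0 1, 0), (y + Pi.single 1 1, 0)} :
      Set HexVertex)).subset ?_
    rintro ⟨z, j⟩ ht
    fin_cases j
    · rcases (hexGraph_adj_iff_of_snd_eq_zero_holds z y).1 ht.symm with rfl | rfl | rfl <;> simp
    · exact absurd ht (not_hexGraph_adj_of_snd_eq_holds _ _ rfl)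

/-- A finite vertex set has finitely many domain mid-edges. -/
theorem hexDomainMidEdges_finite (Λ : Finset HexVertex) : (hexDomainMidEdges Λ).Finite := by
  have h : hexDomainMidEdges Λ ⊆
      ⋃ v ∈ (Λ : Set HexVertex), (fun t => s(v, t)) '' {t : HexVertex | hexGraph.Adj v t} := by
    rintro e ⟨he, v, hve, hvΛ⟩
    refine Set.mem_biUnion hvΛ ⟨Sym2.Mem.other hve, ?_, Sym2.other_spec hve⟩
    have h' : s(v, Sym2.Mem.other hve) ∈ hexGraph.edgeSet := by rwa [Sym2.other_spec hve]
    exact (SimpleGraph.mem_edgeSet _).1 h'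
  exact ((Λ.finite_toSet).biUnion fun v _ => (finite_setOf_adj v).image _).subset h

/-- … hence finitely many boundary mid-edges. -/
theorem hexDomainBoundary_finite (Λ : Finset HexVertex) : (hexDomainBoundary Λ).Finite :=
  (hexDomainMidEdges_finite Λ).subset (hexDomainBoundary_subset Λ)

/-- The swap arc is a finite set of mid-edges. -/
theorem swapArc_finite (D : DobrushinDomain) (ρ : ℝ) (Λ : ℝ → Finset HexVertex) (δ : ℝ) :
    (swapArc D ρ Λ δ).Finite :=
  (hexDomainBoundary_finite (Λ δ)).subset fun _ he => he.1

/-- Monotonicity of finite sums over a finite set of mid-edges. -/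
theorem finsum_mem_mono {S : Set (Sym2 HexVertex)} (hS : S.Finite) {f g : Sym2 HexVertex → ℝ}
    (h : ∀ e ∈ S, f e ≤ g e) : ∑ᶠ e ∈ S, f e ≤ ∑ᶠ e ∈ S, g e := by
  rw [finsum_mem_eq_finite_toFinset_sum f hS, finsum_mem_eq_finite_toFinset_sum g hS]
  exact Finset.sum_le_sum fun e he => h e (hS.mem_toFinset.1 he)

/-- Nonnegativity of such sums. -/
theorem finsum_mem_nonneg_of_finite {S : Set (Sym2 HexVertex)} (hS : S.Finite)
    {f : Sym2 HexVertex → ℝ} (h : ∀ e ∈ S, 0 ≤ f e) : 0 ≤ ∑ᶠ e ∈ S, f e := by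
  rw [finsum_mem_eq_finite_toFinset_sum f hS]
  exact Finset.sum_nonneg fun e he => h e (hS.mem_toFinset.1 he)

theorem massK_nonneg (Λ : Finset HexVertex) (r : Sym2 HexVertex) (δ : ℝ) (K : Set ℂ) :
    0 ≤ massK Λ r δ K := by
  unfold massK
  refine mul_nonneg (sq_nonneg δ) (finsum_nonneg fun e => finsum_nonneg fun _ => Zm_nonneg _ _ _)

/-- **Domain monotonicity** of `σ = 0` masses: the walks of `Λ' ⊆ Λ` are walks of `Λ`
(ideator 6, `IdeatorSixSketch.domainMono`, kernel-checked there; reproduced). -/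
theorem domainMono (Λ Λ' : Finset HexVertex) (r z : Sym2 HexVertex) (hsub : Λ' ⊆ Λ) :
    Zm Λ' r z ≤ Zm Λ r z := by
  unfold Zm
  rw [hexParafermionicObservable_zero_spin, hexParafermionicObservable_zero_spin,
    Complex.norm_real, Complex.norm_real]
  have hx : 0 ≤ hexCriticalFugacity := hexCriticalFugacity_pos_lt_one.1.le
  have h1 : 0 ≤ ∑ γ : HexMidEdgeSAW Λ' r z, hexCriticalFugacity ^ γ.length :=
    Finset.sum_nonneg fun γ _ => pow_nonneg hx _
  have h2 : 0 ≤ ∑ γ : HexMidEdgeSAW Λ r z, hexCriticalFugacity ^ γ.length :=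
    Finset.sum_nonneg fun γ _ => pow_nonneg hx _
  rw [Real.norm_of_nonneg h1, Real.norm_of_nonneg h2]
  let ι : HexMidEdgeSAW Λ' r z → HexMidEdgeSAW Λ r z := fun γ =>
    { verts := γ.verts
      subset := fun v hv => hsub (γ.subset v hv)
      nodup := γ.nodup
      isChain := γ.isChain
      head_mem := γ.head_mem
      getLast_mem := γ.getLast_mem
      eq_of_nil := γ.eq_of_nil
      edges_nodup := γ.edges_nodup
      fst_mem := by
        obtain ⟨he, v, hv, hvΛ⟩ := γ.fst_mem
        exact ⟨he, v, hv, hsub hvΛ⟩ }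
  have hι : Function.Injective ι := by
    intro γ₁ γ₂ h
    have : (ι γ₁).verts = (ι γ₂).verts := by rw [h]
    exact HexMidEdgeSAW.ext this
  have hlen : ∀ γ, (ι γ).length = γ.length := fun γ => rfl
  calc ∑ γ : HexMidEdgeSAW Λ' r z, hexCriticalFugacity ^ γ.length
      = ∑ γ : HexMidEdgeSAW Λ' r z, hexCriticalFugacity ^ (ι γ).length := by simp only [hlen]
    _ = ∑ γ ∈ (Finset.univ : Finset (HexMidEdgeSAW Λ' r z)).map ⟨ι, hι⟩,
          hexCriticalFugacity ^ γ.length := by rw [Finset.sum_map]; rfl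
    _ ≤ ∑ γ : HexMidEdgeSAW Λ r z, hexCriticalFugacity ^ γ.length :=
        Finset.sum_le_sum_of_subset_of_nonneg (Finset.subset_univ _) fun γ _ _ => pow_nonneg hx _

/-- `H_δ ⊆ Λ_δ`. -/
theorem halfDisc_subset (D : DobrushinDomain) (ρ : ℝ) (Λ : ℝ → Finset HexVertex) (δ : ℝ) :
    halfDisc D ρ Λ δ ⊆ Λ δ :=
  Finset.filter_subset _ _

/-! ## Glue (proved) -/

/-- `RootSwap ε → RootSwapArc ε` (sum the pointwise cross-ratio inequality over the finite arc). -/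
theorem rootSwapArc_of_rootSwap {ε : ℝ} (h : RootSwap ε) : RootSwapArc ε := by
  intro D ρ Λ m a b hF K hK hKD
  obtain ⟨C, hC⟩ := h D ρ Λ m a b hF K hK hKD
  refine ⟨C, hC.mono fun δ hδ => ?_⟩
  have hfin := swapArc_finite D ρ Λ δ
  rw [finsum_mem_eq_finite_toFinset_sum _ hfin, finsum_mem_eq_finite_toFinset_sum _ hfin,
    Finset.mul_sum, Finset.mul_sum]
  exact Finset.sum_le_sum fun a' ha' => hδ a' (hfin.mem_toFinset.1 ha')

/-- **The absolute split** of the conjecture node: a far-arc arrival lower bound at exponent `B`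
and an arc-rooted bulk upper bound at exponent `A` with `A + B ≤ c` give `ArcMassRatio c`
(for the lead / tenure planner: the two sharp certifications of the necessity ledger, typed). -/
theorem arcMassRatio_of_split {A B c : ℝ} (hABc : A + B ≤ c) (hArr : HalfDiscArcArrival B)
    (hBulk : ArcRootedBulkMass A) : ArcMassRatio c := by
  intro D ρ Λ m a b hF K hK hKD
  obtain ⟨c₀, hc₀, h₁⟩ := hArr D ρ Λ m a b hF
  obtain ⟨C, h₂⟩ := hBulk D ρ Λ m a b hF K hK hKD
  have h₀ : ∀ᶠ δ : ℝ in nhdsWithin 0 (Set.Ioi 0), 0 < δ := eventually_mem_nhdsWithin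
  have h₀' : ∀ᶠ δ : ℝ in nhdsWithin 0 (Set.Ioi 0), δ < 1 :=
    (eventually_lt_nhds zero_lt_one).filter_mono nhdsWithin_le_nhds
  refine ⟨max C 0 / c₀, ?_⟩
  filter_upwards [h₀, h₀', h₁, h₂] with δ hδ hδ1 hδ₁ hδ₂
  set SH := ∑ᶠ a' ∈ swapArc D ρ Λ δ, Zm (halfDisc D ρ Λ δ) (b δ) a' with hSH_def
  set M := ∑ᶠ a' ∈ swapArc D ρ Λ δ, massK (Λ δ) a' δ K with hM_def
  have hA0 : 0 ≤ δ ^ (-A) := Real.rpow_nonneg hδ.le _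
  have hB0 : 0 < δ ^ B := Real.rpow_pos_of_pos hδ _
  -- `M ≤ max C 0 · δ^{-A}` and `δ^{-A} = δ^{-A-B} δ^{B} ≤ δ^{-c} δ^B ≤ δ^{-c} SH / c₀`
  have step1 : M ≤ max C 0 * δ ^ (-A) :=
    hδ₂.trans (mul_le_mul_of_nonneg_right (le_max_left _ _) hA0)
  have hexp : δ ^ (-A) = δ ^ (-(A + B)) * δ ^ B := by
    rw [← Real.rpow_add hδ]; congr 1; ring
  have hmono : δ ^ (-(A + B)) ≤ δ ^ (-c) :=
    Real.rpow_le_rpow_of_exponent_ge hδ hδ1.le (by linarith)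
  have step2 : δ ^ (-A) ≤ δ ^ (-c) * (SH / c₀) := by
    rw [hexp]
    have h3 : δ ^ B ≤ SH / c₀ := by
      rw [le_div_iff₀ hc₀]; linarith [hδ₁]
    exact mul_le_mul hmono h3 hB0.le (Real.rpow_nonneg hδ.le _)
  calc M ≤ max C 0 * δ ^ (-A) := step1
    _ ≤ max C 0 * (δ ^ (-c) * (SH / c₀)) := mul_le_mul_of_nonneg_left step2 (le_max_right _ _)
    _ = max C 0 / c₀ * δ ^ (-c) * SH := by
        field_simp

/-- **FIRST LEMMA / Transfer at a general cut** (the card's `FirstLemma`, with the division step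
made explicit as `SwapArcPositive`): `RootSwapArc ε`, `ArcMassRatio c` and positivity of the arc
mass give `MassRatioAt (c + ε)`. Proof: multiply the crux's LHS by the arc mass
`S_Λ = Z_{Λ_δ}(b_δ → S_δ) > 0`, apply the root swap, bound the arc-rooted bulk mass by
`ArcMassRatio`, push `Z_{H_δ}(b_δ → a') ≤ Z_{Λ_δ}(b_δ → a')` termwise by `domainMono`
(`H_δ ⊆ Λ_δ`), multiply the exponents and divide by `S_Λ`. -/
theorem massRatioAt_of {ε c : ℝ} (hR : RootSwapArc ε) (hA : ArcMassRatio c)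
    (hP : SwapArcPositive) : MassRatioAt (c + ε) := by
  intro D ρ Λ m a b hF K hK hKD
  obtain ⟨C₁, h₁⟩ := hA D ρ Λ m a b hF K hK hKD
  obtain ⟨C₂, h₂⟩ := hR D ρ Λ m a b hF K hK hKD
  have h₃ := hP D ρ Λ m a b hF
  have h₀ : ∀ᶠ δ : ℝ in nhdsWithin 0 (Set.Ioi 0), 0 < δ := eventually_mem_nhdsWithin
  refine ⟨max C₂ 0 * max C₁ 0, ?_⟩
  filter_upwards [h₀, h₁, h₂, h₃] with δ hδ hδ₁ hδ₂ hδ₃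
  have hfin : (swapArc D ρ Λ δ).Finite := swapArc_finite D ρ Λ δ
  set SΛ := ∑ᶠ a' ∈ swapArc D ρ Λ δ, Zm (Λ δ) (b δ) a' with hSΛ_def
  set SH := ∑ᶠ a' ∈ swapArc D ρ Λ δ, Zm (halfDisc D ρ Λ δ) (b δ) a' with hSH_def
  set M := ∑ᶠ a' ∈ swapArc D ρ Λ δ, massK (Λ δ) a' δ K with hM_def
  have hM0 : 0 ≤ M := finsum_mem_nonneg_of_finite hfin fun a' _ => massK_nonneg _ _ _ _
  have hSH0 : 0 ≤ SH := finsum_mem_nonneg_of_finite hfin fun a' _ => Zm_nonneg _ _ _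
  have hSH : SH ≤ SΛ :=
    finsum_mem_mono hfin fun a' _ => domainMono _ _ _ _ (halfDisc_subset D ρ Λ δ)
  have hZ0 : 0 ≤ Zm (Λ δ) (a δ) (b δ) := Zm_nonneg _ _ _
  have hε0 : 0 ≤ δ ^ (-ε) := Real.rpow_nonneg hδ.le _
  have hc0 : 0 ≤ δ ^ (-c) := Real.rpow_nonneg hδ.le _
  -- step 1: root swap, with a nonnegative constant
  have step1 : massK (Λ δ) (a δ) δ K * SΛ ≤ max C₂ 0 * δ ^ (-ε) * Zm (Λ δ) (a δ) (b δ) * M := by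
    refine hδ₂.trans ?_
    have hx : 0 ≤ δ ^ (-ε) * Zm (Λ δ) (a δ) (b δ) * M := mul_nonneg (mul_nonneg hε0 hZ0) hM0
    calc C₂ * δ ^ (-ε) * Zm (Λ δ) (a δ) (b δ) * M
        = C₂ * (δ ^ (-ε) * Zm (Λ δ) (a δ) (b δ) * M) := by ring
      _ ≤ max C₂ 0 * (δ ^ (-ε) * Zm (Λ δ) (a δ) (b δ) * M) :=
          mul_le_mul_of_nonneg_right (le_max_left _ _) hx
      _ = max C₂ 0 * δ ^ (-ε) * Zm (Λ δ) (a δ) (b δ) * M := by ring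
  -- step 2: arc mass ratio, then `H_δ ⊆ Λ_δ`
  have step2 : M ≤ max C₁ 0 * δ ^ (-c) * SΛ := by
    refine hδ₁.trans ?_
    have hx : 0 ≤ δ ^ (-c) * SH := mul_nonneg hc0 hSH0
    calc C₁ * δ ^ (-c) * SH = C₁ * (δ ^ (-c) * SH) := by ring
      _ ≤ max C₁ 0 * (δ ^ (-c) * SH) := mul_le_mul_of_nonneg_right (le_max_left _ _) hx
      _ = max C₁ 0 * δ ^ (-c) * SH := by ring
      _ ≤ max C₁ 0 * δ ^ (-c) * SΛ :=
          mul_le_mul_of_nonneg_left hSH (mul_nonneg (le_max_right _ _) hc0)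
  -- exponents add
  have hexp : δ ^ (-ε) * δ ^ (-c) = δ ^ (-(c + ε)) := by
    rw [← Real.rpow_add hδ]; congr 1; ring
  have step3 : massK (Λ δ) (a δ) δ K * SΛ ≤
      (max C₂ 0 * max C₁ 0 * δ ^ (-(c + ε)) * Zm (Λ δ) (a δ) (b δ)) * SΛ := by
    calc massK (Λ δ) (a δ) δ K * SΛ
        ≤ max C₂ 0 * δ ^ (-ε) * Zm (Λ δ) (a δ) (b δ) * M := step1
      _ ≤ max C₂ 0 * δ ^ (-ε) * Zm (Λ δ) (a δ) (b δ) * (max C₁ 0 * δ ^ (-c) * SΛ) :=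
          mul_le_mul_of_nonneg_left step2 (mul_nonneg (mul_nonneg (le_max_right _ _) hε0) hZ0)
      _ = (max C₂ 0 * max C₁ 0 * (δ ^ (-ε) * δ ^ (-c)) * Zm (Λ δ) (a δ) (b δ)) * SΛ := by ring
      _ = (max C₂ 0 * max C₁ 0 * δ ^ (-(c + ε)) * Zm (Λ δ) (a δ) (b δ)) * SΛ := by rw [hexp]
  exact le_of_mul_le_mul_right step3 hδ₃

/-- The same with the POINTWISE root swap. -/
theorem massRatioAt_of_rootSwap {ε c : ℝ} (hR : RootSwap ε) (hA : ArcMassRatio c)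
    (hP : SwapArcPositive) : MassRatioAt (c + ε) :=
  massRatioAt_of (rootSwapArc_of_rootSwap hR) hA hP

/-! ## Composition: the line concludes the crux by name -/

/-- **The line concludes the crux.** `MassRatio` from the three stubs: `c < 3/4` with
`ArcMassRatio c` (stub 2), the root swap at `ε := 3/4 − c > 0` (stub 1), positivity of the swap
arc (stub 3), through `massRatioAt_of` at the cut `c + ε = 3/4`. -/
theorem MassRatio_of : MassRatio := by
  obtain ⟨c, hc, hA⟩ := arcMassRatio_of_stub
  have hR : RootSwapArc (3 / 4 - c) := rootSwapArc_of_stub (by linarith)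
  have h : MassRatioAt (3 / 4) := by
    have h' := massRatioAt_of hR hA swapArcPositive_of_stub
    have e : c + (3 / 4 - c) = 3 / 4 := by ring
    rw [e] at h'
    exact h'
  intro D ρ Λ m a b Z hρ hflat hadm hexh ha hb K hK hKD
  obtain ⟨C, hC⟩ := h D ρ Λ m a b ⟨hρ, hflat, hadm, hexh, ha, hb⟩ K hK hKD
  refine ⟨C, hC.mono fun δ hδ => ?_⟩
  rw [neg_div]
  exact hδ

end

end Summit.CriticalPhenomena.SAWScalingLimit.Cruxes.MassRatio.FlatRootArcSwap
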